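import Mathlib
import Summits.ValiantsHypothesis.ValiantsHypothesis.Theses.ElementaryWordLength

/-!
# Crux `UnboundedReads` (stmt-ValiantsHypothesis-6627) — ideator 2 sketch (round 1)

First lemmas of two idea cards, stated over Mathlib + the route file; `sorry` only in the
lemmas the cards propose (the unfolding lemma `unboundedReads_iff` is proved).

* Card `interval-signature-squares` (A): evaluation dimension.  `extraction` (read-`k`
  sequences have two dense colour classes with `≤ 2k` runs), `word_evalDim_le` (a width-3 word
  with `m` colour runs has evaluation dimension `≤ 3^m`), `per_evalDim_dense` (dense disjoint
  `Y, Z ⊆ [n]²` give `2^r` via `r ≈ min(|Y|,|Z|)/4n` row/column-disjoint straddling squares).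
* Card `transversal-transcendence` (B): Kalorkoti in the word model with a TRANSVERSAL block.
  `zdSubper n b S` = the zero-diagonal subpermanents `Q_S` (coefficients of `per_n` in the block
  `{x_ii : i < b}`), `segment_adjoin` (a word with `ℓ` letters in the block puts every `Q_S` in a
  subalgebra with `9(ℓ+1)` generators), `ZeroDiagIndependent b` (the `2^b` polynomials `Q_S` are
  algebraically independent for `n ≥ n₀(b)`; Jacobian certificates for `b ≤ 6` in
  `compute/jacobian_rank.py`), and the composition `unboundedReads_of_transversal`.
-/

open MvPolynomial

namespace Summit.ValiantsHypothesis.ValiantsHypothesis.Cruxes.UnboundedReads.Ideator2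

open Literature.Computability.AlgebraicComplexity (perPoly)

/-- A letter of an affine elementary word in `E_3(ℂ[x_ij])`, as in the route file. -/
abbrev Letter (n : ℕ) := Fin 3 × Fin 3 × ℂ × Option (Fin n × Fin n)

/-- The matrix `E_{ij}(λ)` / `E_{ij}(λ x_kl)` of a letter (verbatim the route's map). -/
noncomputable def letterMat {n : ℕ} (l : Letter n) :
    Matrix (Fin 3) (Fin 3) (MvPolynomial (Fin n × Fin n) ℂ) :=
  Matrix.transvection l.1 l.2.1 (C l.2.2.1 * l.2.2.2.elim 1 X)

/-- `w` is an affine elementary word for the transvection `E_02(per_n)`. -/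
def IsPerWord (n : ℕ) (w : List (Letter n)) : Prop :=
  (∀ l ∈ w, l.1 ≠ l.2.1) ∧
    (w.map letterMat).prod = Matrix.transvection (0 : Fin 3) 2 (perPoly (Fin n) ℂ)

/-- Number of letters of `w` reading the variable `x`. -/
def reads {n : ℕ} (w : List (Letter n)) (x : Fin n × Fin n) : ℕ :=
  (w.filter (fun l => decide (l.2.2.2 = some x))).length

/-- The crux, unfolded into this file's vocabulary (proved, no sorry). -/
theorem unboundedReads_iff :
    Theses.ElementaryWordLength.UnboundedReads ↔
      ∀ k : ℕ, ∃ n₀ : ℕ, ∀ n ≥ n₀, ∀ w : List (Letter n), IsPerWord n w → ∃ x, k < reads w x := by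
  unfold Theses.ElementaryWordLength.UnboundedReads IsPerWord reads letterMat
  constructor
  · intro h k
    obtain ⟨n₀, hn₀⟩ := h k
    exact ⟨n₀, fun n hn w hw => hn₀ n hn w hw.1 hw.2⟩
  · intro h k
    obtain ⟨n₀, hn₀⟩ := h k
    exact ⟨n₀, fun n hn w h1 h2 => hn₀ n hn w ⟨h1, h2⟩⟩

/-! ## Card A — interval signatures and straddling squares (evaluation dimension) -/

/-- Keep the variables in `keep`, substitute the constant `α i` for every other variable. -/
noncomputable def restrictTo {σ : Type*} [DecidableEq σ] (keep : Finset σ) (α : σ → ℂ)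
    (f : MvPolynomial σ ℂ) : MvPolynomial σ ℂ :=
  aeval (fun i => if i ∈ keep then X i else C (α i)) f

/-- Evaluation dimension of `f` with respect to the variables `Y` (Nisan 1991 / Forbes–Shpilka):
the dimension of the span of all partial evaluations of the `Y`-variables at points of `ℂ^Y`
(= the rank of the coefficient matrix of `f` for the partition `Y | Yᶜ`). -/
noncomputable def evalDim {σ : Type*} [DecidableEq σ] (Y : Finset σ) (f : MvPolynomial σ ℂ) : ℕ :=
  Module.finrank ℂ
    (Submodule.span ℂ (Set.range fun α : σ → ℂ => aeval (fun i => if i ∈ Y then C (α i) else X i) f))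

/-- Number of maximal runs of a two-colour sequence. -/
def runs : List Bool → ℕ
  | [] => 0
  | [_] => 1
  | a :: b :: l => (if a = b then 0 else 1) + runs (b :: l)

/-- The colour sequence of a list of symbols: `Y ↦ true`, `Z ↦ false`, other symbols dropped. -/
def colourSeq {α : Type*} [DecidableEq α] (Y Z : Finset α) (s : List α) : List Bool :=
  s.filterMap fun a => if a ∈ Y then some true else if a ∈ Z then some false else none

/-- The variable letters of a word, in order (constant letters dropped). -/
def varSeq {n : ℕ} (w : List (Letter n)) : List (Fin n × Fin n) :=
  w.filterMap fun l => l.2.2.2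

/-- **A1 · extraction (AFSSV-free, interval signatures).** In a sequence over `N` symbols in which
every symbol occurs between `1` and `k` times, cut the time line into `4k²` intervals of equal
letter mass and class the symbols by the set of intervals they touch (`≤ (4k²+1)^k` classes):
the largest class `Y` and the largest class `Z` among the `≥ N/2` symbols whose signature misses
`Y`'s give two disjoint sets of density `≥ 1/(2(4k²+1)^k)` whose joint colour sequence has at
most `2k` runs. [difficulty S/M; pigeonhole only] -/
theorem extraction {α : Type*} [Fintype α] [DecidableEq α] (k : ℕ) (hk : 1 ≤ k) (s : List α)
    (hs : ∀ a, s.count a ≤ k) (hs' : ∀ a, 1 ≤ s.count a) (hN : 4 * k ≤ Fintype.card α) :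
    ∃ Y Z : Finset α, Disjoint Y Z ∧
      Fintype.card α ≤ 2 * (4 * k ^ 2 + 1) ^ k * Y.card ∧
      Fintype.card α ≤ 2 * (4 * k ^ 2 + 1) ^ k * Z.card ∧
      runs (colourSeq Y Z s) ≤ 2 * k := by
  sorry

/-- **A2 · few runs ⇒ small evaluation dimension.** After every variable outside `Y ∪ Z` is
replaced by a constant (letters stay letters), a word whose `Y/Z` colour sequence has `m` runs is
a product `G₀ P₁ G₁ ⋯ P_m G_m` with `P_b` over `ℂ[Y]` or `ℂ[Z]` alternately, so every entry is a sum
of `≤ 3^(m-1)` pure tensors `u(Y) · v(Z)`. [difficulty M: needs the finrank API for spans] -/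
theorem word_evalDim_le (n : ℕ) (Y Z : Finset (Fin n × Fin n)) (hYZ : Disjoint Y Z)
    (w : List (Letter n)) (α : Fin n × Fin n → ℂ) (i j : Fin 3) :
    evalDim Y (restrictTo (Y ∪ Z) α ((w.map letterMat).prod i j)) ≤ 3 ^ runs (colourSeq Y Z (varSeq w)) := by
  sorry

/-- **A3 · the per-side rank lemma for DENSE adaptive pairs (straddling squares).** If `Y, Z` are
disjoint sets of positions with more than `4rn` elements each and `2r+2 ≤ n`, greedily pick `r`
row- and column-disjoint `2×2` squares each containing a `Y`-cell and a `Z`-cell; put `1` on the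
other cells of the squares and on a perfect matching of the leftover rows/columns, `0` elsewhere:
killing the stray `Y/Z` variables (a substitution inside each tensor factor, which cannot raise
the rank) leaves `∏_t per(square_t)`, each factor of rank `2`, so `evalDim ≥ 2^r`.
[difficulty M] -/
theorem per_evalDim_dense (n r : ℕ) (Y Z : Finset (Fin n × Fin n)) (hYZ : Disjoint Y Z)
    (hY : 4 * r * n < Y.card) (hZ : 4 * r * n < Z.card) (hn : 2 * r + 2 ≤ n) :
    ∃ α : Fin n × Fin n → ℂ, (∀ x, α x = 0 ∨ α x = 1) ∧
      2 ^ r ≤ evalDim Y (restrictTo (Y ∪ Z) α (perPoly (Fin n) ℂ)) := by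
  sorry

/-- The smallest instance of A3, stated on its own as the cheapest falsifier of the card:
two disjoint straddling squares inside `per_4` already beat width `3` (`evalDim = 4 > 3`). -/
theorem per4_two_squares :
    4 ≤ evalDim ({((0 : Fin 4), (0 : Fin 4)), (2, 2)} : Finset (Fin 4 × Fin 4))
      (restrictTo ({((0 : Fin 4), (0 : Fin 4)), (2, 2), (1, 1), (3, 3)} : Finset (Fin 4 × Fin 4))
        (fun x => if x = (0, 1) ∨ x = (1, 0) ∨ x = (2, 3) ∨ x = (3, 2) then 1 else 0)
        (perPoly (Fin 4) ℂ)) := by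
  sorry

/-! ## Card B — transversal blocks: Kalorkoti's transcendence measure in the word model -/

/-- **The zero-diagonal subpermanent `Q_S`** (`S ⊆ {0,…,b-1}`): the permanent of the generic
matrix with the transversal block `{x_ii : i < b}` set to `0` and the rows and columns `S`
deleted — the coefficient of `∏_{i ∈ S} x_ii` when `per_n` is read as a polynomial in the block
variables with coefficients in `ℂ[other x_kl]`. -/
noncomputable def zdSubper (n b : ℕ) (S : Finset (Fin n)) : MvPolynomial (Fin n × Fin n) ℂ :=
  Matrix.permanent fun i j : {i : Fin n // i ∉ S} =>
    if i.1 = j.1 ∧ (i.1 : ℕ) < b then 0 else X (i.1, j.1)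

/-- The block expansion `per_n = ∑_{S ⊆ [b]} (∏_{i∈S} x_ii) · Q_S` (Laplace along the transversal;
provable now). -/
theorem perPoly_eq_sum_zdSubper (n b : ℕ) :
    perPoly (Fin n) ℂ =
      ∑ S ∈ (Finset.univ.filter fun i : Fin n => (i : ℕ) < b).powerset,
        (∏ i ∈ S, X (i, i)) * zdSubper n b S := by
  sorry

/-- Number of letters of `w` reading a variable of the transversal block `{x_ii : i < b}`. -/
def blockLetters {n : ℕ} (b : ℕ) (w : List (Letter n)) : ℕ :=
  (w.filter fun l => decide (∃ i : Fin n, (i : ℕ) < b ∧ l.2.2.2 = some (i, i))).length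

/-- **B1 · segment lemma (route engine E1, transversal form).** Split a word for `E_02(per_n)` at
its `ℓ` block letters: `S₀ L₁ S₁ ⋯ L_ℓ S_ℓ` with block-free segments `S_t ∈ SL₃(ℂ[x_kl : (k,l) ∉ block])`.
Expanding `L_t = 1 + λ_t x E_{i_t j_t}` and comparing coefficients of the block monomials (which are
`ℂ[other]`-linearly independent) writes every `Q_S` as a `ℂ`-polynomial in the `9(ℓ+1)` segment
entries. Hence `trdeg_ℂ ℂ(Q_S : S) ≤ 9(ℓ+1)` (indeed `≤ 4ℓ + O(1)` after gauge-fixing).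
[difficulty M] -/
theorem segment_adjoin (n b : ℕ) (w : List (Letter n)) (hw : IsPerWord n w) :
    ∃ g : Fin (9 * (blockLetters b w + 1)) → MvPolynomial (Fin n × Fin n) ℂ,
      ∀ S : Finset (Fin n), (∀ i ∈ S, (i : ℕ) < b) →
        zdSubper n b S ∈ Algebra.adjoin ℂ (Set.range g) := by
  sorry

/-- **B2 · zero-diagonal subpermanent independence (the card's crux).** For fixed `b` and all
large `n` the `2^b` polynomials `Q_S`, `S ⊆ [b]`, are algebraically independent over `ℂ`.
Numerically certified (Jacobian of full rank `2^b` mod `2^31-1` at a random integer point,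
`compute/jacobian_rank.py`): `b = 2,3,4 (n = b+1)`, `b = 5 (n = 7)`, `b = 6 (n = 9)`; the generic
rank is exactly `min(2^b, (n-1)^2+1)` in every case computed (torus cap), versus
`b² - b + 2` for the determinant (Jacobi's complementary-minor identity) — the per/det split that
makes the transversal the right block for PER. -/
def ZeroDiagIndependent (b : ℕ) : Prop :=
  ∃ n₀ : ℕ, ∀ n ≥ n₀,
    AlgebraicIndependent ℂ fun S : {S : Finset (Fin n) // ∀ i ∈ S, (i : ℕ) < b} => zdSubper n b S.1

/-- **B3 · composition.** `2^b` independent elements inside a subalgebra with `9(ℓ+1)` generators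
force `2^b ≤ 9(ℓ+1) ≤ 9(kb+1)` for a read-`k` word; take `b` with `2^b > 9(kb+1)` and
`n ≥ max(n₀(b), b)`. [arithmetic + `AlgebraicIndependent.lift_cardinalMk_le_trdeg`] -/
theorem unboundedReads_of_transversal (hB2 : ∀ b, ZeroDiagIndependent b)
    (hB1 : ∀ n b (w : List (Letter n)), IsPerWord n w →
      ∃ g : Fin (9 * (blockLetters b w + 1)) → MvPolynomial (Fin n × Fin n) ℂ,
        ∀ S : Finset (Fin n), (∀ i ∈ S, (i : ℕ) < b) →
          zdSubper n b S ∈ Algebra.adjoin ℂ (Set.range g)) :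
    Theses.ElementaryWordLength.UnboundedReads := by
  sorry

/-- Fixed-`k` instances need only ONE certified `b`: e.g. `ZeroDiagIndependent 6` (certified at
`n₀ = 9` numerically; `2^6 = 64 > 9·(1·6+1) = 63`) already excludes read-once words. -/
theorem no_readOnce_of_b6 (hB2 : ZeroDiagIndependent 6)
    (hB1 : ∀ n b (w : List (Letter n)), IsPerWord n w →
      ∃ g : Fin (9 * (blockLetters b w + 1)) → MvPolynomial (Fin n × Fin n) ℂ,
        ∀ S : Finset (Fin n), (∀ i ∈ S, (i : ℕ) < b) →
          zdSubper n b S ∈ Algebra.adjoin ℂ (Set.range g)) :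
    ∃ n₀ : ℕ, ∀ n ≥ n₀, ∀ w : List (Letter n), IsPerWord n w → ∃ x, 1 < reads w x := by
  sorry

end Summit.ValiantsHypothesis.ValiantsHypothesis.Cruxes.UnboundedReads.Ideator2
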